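import Literature.IUT.LogThetaLattice.GlobalPacketsLGP
import Literature.IUT.LogThetaLattice.VerticallyCoricLGPBadPackets
import Literature.IUT.HodgeArakelov.GaussianSplittingMonoidsPush
import Literature.IUT.HodgeArakelov.BadPrimeGaussianMonoids
import HarnessLib

/-!
# [IUTchIII] Proposition 3.4 (ii): the LGP-monoids CONSTRUCTED — `LGPMonoidSignature.ofGaussian`, the
# construct-after-merge inhabitant of the output signature over the real tensor packets, the literal `𝓘^ℚ`,
# and the Gaussian monoids of [IUTchII] Cor. 3.5/3.6/4.6 (iv)

S. Mochizuki, *Inter-universal Teichmüller theory III*, kurims manuscript (May 2020) `paper:url-4b091feeb646`,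
§3, Proposition 3.4 (ii) "(Local Logarithmic Gaussian Procession Monoids)", p. 102 l. 20 – p. 103 l. 24 (PRIMS
offset ≈ +420) [claim: Mochizuki2012, status: disputed] for every quoted sentence; abc-iut cell, layer L6, seat
abc-iut-L6-t4 (typer of record of [IUTchIII] §3; gen 4). Node IUTchIII:Prop3.4(ii); sub-DAG
`plan/L6/SUBDAG-IUTchIII-Prop-34.md` rows **r14** (the construction), **r11** (the identity "`Ψ v j =` single
packet monoid of the label-`j` component"), **r16 / r17** (the two printed properties), and the junction to
Proposition 3.5 (ii)(c) (abc-iut-w4-d036 `prop35ii_c_shellPacketAt`).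

PRINT (p. 102 l. 31–47): "by applying the various constructions of 'single packet monoids' given in (i) in the
case of … the label `j ∈ {1, …, l⋇}` … that appears in the `(j+1)`-capsule of the ‡-procession — to the
pull-backs, via the poly-isomorphisms that appear in the definition [cf. Definition 1.1, (iii)] of the given
log-link, of the [collections of] monoids … `Ψ_{𝓕gau}(†𝓗𝓣^Θ)_v`, `∞Ψ_{𝓕gau}(†𝓗𝓣^Θ)_v` of [IUTchII], Corollary 4.6,
(iv), for `v ∈ V`, one obtains a functorial algorithm … `V ∋ v ↦ Ψ_{𝓕LGP}(†𝓗𝓣^{Θ±ellNF})_v`; `V ∋ v ↦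
∞Ψ_{𝓕LGP}(†𝓗𝓣^{Θ±ellNF})_v`"; (p. 103 l. 5–24) "For `v ∈ V^bad`, the component labeled `j` … of the submonoid of Galois
invariants … of the entire LGP-monoid … is a subset of `𝓘^ℚ(^{S^±_{j+1},j;‡}𝓕_v)` … that acts multiplicatively on
`𝓘^ℚ(…)`"; "For any `v ∈ V`, the component labeled `j` … of the submodule of Galois invariants … of the unit portion
`Ψ_{𝓕LGP}(…)^×_v` … is a subset of `𝓘^ℚ(…)` … that acts multiplicatively on `𝓘^ℚ(…)`". Prop. 3.2 (ii) p. 99: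
"`𝓘^ℚ((−))` … the `ℚ`-span of `𝓘((−))`".

WHAT IS BUILT (places of one nonarchimedean fibre `Vfib = {v ∣ p}`; all bad places are nonarchimedean):
* carriers `LGPPacket p K v j` := abc-iut-L6-t4's REAL `(S^±_{j+1}, j)`-tensor packet `log(^{S^±_{j+1},j;‡}𝓕_v) =
  K_v ⊗_{ℚ_p} (⊗_{β≠j} ⊕_{w∣p} K_w)` (`PacketAt`, p403825; every factor of the `(j+1)`-capsule of the ‡-procession is
  the ‡-local field `K_w`); `𝓘 := lgpShell` = the packet log-shell `shellPacketAt` of abc-iut-L4-t3's `logShell (Lg w)`;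
  **`𝓘^ℚ := lgpShellQ`** = the typed `ℚ_p`-span `shellQSpan ℚ_[p]` with scalars restricted to `ℚ` (the object of
  abc-iut-w4-d036 p412324 / w5-d086 p421013), = ⊤ BY NAME (`lgpShellQ_eq_top`) and EQUAL to print's LITERAL `ℚ`-span
  (`lgpShellQ_eq_shellQSpan_rat`, via `span_rat_shellPacketAt_eq_top` = the `ℚ`-form of w4-d036's theorem, proved here);
* inputs per place `v`: the †-side data of [IUTchII] Cor. 4.6 (iv) — a commutative monoid `M v` (`≅ Ψ_{†𝒞_v} ≅ 𝒪^▷`),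
  its `G_v`-action (`Γ v`, by monoid automorphisms), the Gaussian monoid `gau v ⊆ ∏_{F_l^⋇} M v`, `∞`-version
  `gauInf v` and (bad `v`) splitting `split v ⊆ gau v` — instantiated below at abc-iut-L6-t2's REAL `gaussianMonoid ξ =
  Ψ^×_{⟨F_l^⋇⟩}·ξ^ℕ` / `inftyGaussianMonoid ξ` / `gaussianSplittingMonoid = μ_{2l}^{diag}·ξ^ℕ` (p403904,
  `GaussianSplittingMonoids.lean`) — and ONE member `ι v : M v →* K v` of the pull-back ("the poly-isomorphisms that
  appear in the definition of the given log-link", Def. 1.1 (iii): `†𝔉_v ⥲ log(‡𝔉_v)` on the monoids, then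
  `𝒪^▷(log ‡𝔉_v) ⊆ log(‡𝔉_v) = K_v`). The member is an EXPLICIT PARAMETER: abc-iut-L6-t3's `LogLink.polyIso` lives in an
  abstract `StripFrame` and carries no ring-level member (honest residual, not hidden);
* `LGPMonoidSignature.ofGaussian`: the entire LGP-monoid `⊆ ∏_j log(^{S^±_{j+1},j;‡}𝓕_v)` is `gau v` read through the
  label-dependent push `j ↦ toPacketAt_j ∘ ι v` (abc-iut-L6-t2's `piMap` shape); the signature records its label-`j`
  COMPONENTS `lgpComponent`: `Ψ` / `ΨInf` / `ΨSplit`, `ΨGal` = components of the `Γ v`-FIXED part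
  (`FixedPoints.submonoid`), `ΨUnitsGal` = of the fixed units; the four printed properties are PROVED;
* r11 `ofGaussian_Ψ`: `Ψ v j` = abc-iut-L6-t4's `singlePacketMonoid` (Prop. 3.4 (i)) of the label-`j` component;
* `LGPMonoidSignature.ofValueProfile` + `ofValueProfile_ΨSplit_le`: for a value-profile `ξ = (ζ_j · q^{j²})_j` ([IUTchII]
  Rmk. 2.5.1, Cor. 3.5 (ii)) the label-`j` splitting monoid lands in abc-iut-L6-t2's `splittingMonoidAt K_v 2l (ι q) j =
  μ_{2l}·q^{j²ℕ}` pushed to the packet — the object of abc-iut-w4-d036's packet-level Prop. 3.5 (ii)(c).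

HONEST SCOPE: archimedean places (units clause of p. 103 l. 14–24 only; Hermitian packets) are NOT built here;
topologies / "actions by topological groups" enter only through the fixed-point submonoid; "functorial algorithm"
= a definition in the inputs. No `Prop`-valued definition, no instance; nothing here asserts abc proved or refuted
or takes a side on [IUTchIII] Cor. 3.12; typed ≠ discharged elsewhere; instantiated ≠ endorsed.
-/

noncomputable section

namespace Literature.IUT.LogThetaLattice

open Set Metric Filter
open Literature.IUT.HodgeArakelov Literature.AnabelianGeometry.AbsoluteAnabelian
open scoped TensorProduct
open PiTensorProduct

universe v v' w w' w''

/-! ### 1. `𝓘^ℚ` as the literal `ℚ`-span: it is the whole packet -/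

section RatSpan

variable (p : ℕ) [Fact p.Prime]

/-- `‖p^n · e‖ ≤ 1` for all large `n`, in any seminormed `ℚ_p`-module with bounded scalar multiplication
(`‖p‖ = p⁻¹ < 1`). [folklore] -/
private theorem eventually_norm_pow_smul_le_one' {E : Type*} [SeminormedAddCommGroup E]
    [Module ℚ_[p] E] [IsBoundedSMul ℚ_[p] E] (e : E) :
    ∀ᶠ n : ℕ in atTop, ‖((p : ℚ_[p]) ^ n) • e‖ ≤ 1 := by
  have hp1 : ‖(p : ℚ_[p])‖ < 1 := by
    rw [Padic.norm_p]
    exact inv_lt_one_of_one_lt₀ (by exact_mod_cast (Fact.out : p.Prime).one_lt)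
  have ht : Tendsto (fun n : ℕ => ‖(p : ℚ_[p])‖ ^ n * ‖e‖) atTop (nhds (0 * ‖e‖)) :=
    (tendsto_pow_atTop_nhds_zero_of_lt_one (norm_nonneg _) hp1).mul_const _
  rw [zero_mul] at ht
  filter_upwards [ht.eventually_lt_const zero_lt_one] with n hn
  calc ‖((p : ℚ_[p]) ^ n) • e‖ ≤ ‖(p : ℚ_[p]) ^ n‖ * ‖e‖ := norm_smul_le _ _
    _ = ‖(p : ℚ_[p])‖ ^ n * ‖e‖ := by rw [norm_pow]
    _ ≤ 1 := hn.le

variable {A : Type v} [Fintype A] {Vfib : Type v'} [Fintype Vfib]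
variable (K : A → Vfib → Type w) [∀ α v, NontriviallyNormedField (K α v)]
  [∀ α v, Algebra ℚ_[p] (K α v)] [∀ α v, IsBoundedSMul ℚ_[p] (K α v)] [∀ α v, IsUltrametricDist (K α v)]
  [∀ α v, CharZero (K α v)]
variable (Lg : ∀ α v, PadicLogOnUnits (K α v))

/-- **[IUTchIII] Prop. 3.2 (ii) p. 99 "`𝓘^ℚ((−))` … the `ℚ`-span of `𝓘((−))`" — read LITERALLY over `ℚ`, the span of
the `(A, α)`-packet log-shell `𝓘(^{A,α}𝒟^⊢_v)` (abc-iut-L6-t4's `shellPacketAt` of abc-iut-L4-t3's log-shells) is the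
WHOLE packet `log(^{A,α}𝒟^⊢_v)`**: a pure tensor `x ⊗ (⊗_β y_β)` is `(p^N)⁻¹ ∈ ℚ` times the INTEGRAL pure tensor
`(p^n x) ⊗ (⊗_β p^n y_β)` (`N = n·(1 + |A∖{α}|)`), integers lie in the log-shells ([IUTchIII] Rmk. 1.2.2 (i)
"`𝒪 ⊆ ℐ`", `closedBall_subset_logShell`), and pure tensors absorb `ℚ_p`-scalars into their first factor. (The
`ℚ_p`-span version is abc-iut-w4-d036's `shellQSpan_shellPacketAt_eq_top`.) PROVED.
[cite: Mochizuki2012, Prop. 3.2 (ii) p.99] [claim: Mochizuki2012, status: disputed] -/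
theorem span_rat_shellPacketAt_eq_top (α : A) (v : Vfib) :
    Submodule.span ℚ
      (shellPacketAt ℚ_[p] K (fun α v => AddSubgroup.closure (logShell (Lg α v))) α v :
        Set (MPacketAt ℚ_[p] K α v)) = ⊤ := by
  classical
  set W := Submodule.span ℚ
      (shellPacketAt ℚ_[p] K (fun α v => AddSubgroup.closure (logShell (Lg α v))) α v :
        Set (MPacketAt ℚ_[p] K α v)) with hW
  have hp0 : (p : ℚ_[p]) ≠ 0 := by exact_mod_cast (Fact.out : p.Prime).ne_zero
  -- every pure tensor lies in `W`
  have hA : ∀ (x : K α v) (y : ∀ β : {β : A // β ≠ α}, MPacket1 K β.1),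
      x ⊗ₜ[ℚ_[p]] tprod ℚ_[p] y ∈ W := by
    intro x y
    obtain ⟨n, hnx, hny⟩ : ∃ n : ℕ, ‖((p : ℚ_[p]) ^ n) • x‖ ≤ 1 ∧
        ∀ β : {β : A // β ≠ α}, ∀ w : Vfib, ‖((p : ℚ_[p]) ^ n) • y β w‖ ≤ 1 := by
      have h1 := eventually_norm_pow_smul_le_one' p x
      have h2 : ∀ᶠ n : ℕ in atTop, ∀ βw : {β : A // β ≠ α} × Vfib,
          ‖((p : ℚ_[p]) ^ n) • y βw.1 βw.2‖ ≤ 1 :=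
        eventually_all.mpr fun βw => eventually_norm_pow_smul_le_one' p (y βw.1 βw.2)
      obtain ⟨n, hn1, hn2⟩ := (h1.and h2).exists
      exact ⟨n, hn1, fun β w => hn2 (β, w)⟩
    set c : ℚ_[p] := (p : ℚ_[p]) ^ n with hc
    -- the integral pure tensor is a generator of the packet log-shell
    have hmem : (c • x) ⊗ₜ[ℚ_[p]] tprod ℚ_[p] (fun β => c • y β) ∈ W := by
      refine Submodule.subset_span (AddSubgroup.subset_closure ⟨c • x, fun β => c • y β, ?_, fun β => ?_, rfl⟩)
      · exact AddSubgroup.subset_closure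
          (closedBall_subset_logShell (Lg α v) (by rwa [mem_closedBall, dist_zero_right]))
      · exact (AddSubgroup.mem_pi _).mpr fun w _ => AddSubgroup.subset_closure
          (closedBall_subset_logShell (Lg β.1 w) (by rw [mem_closedBall, dist_zero_right]; exact hny β w))
    -- and it is `p^N` times the given pure tensor, `p^N ∈ ℕ ⊆ ℚ`
    have hrel : (c • x) ⊗ₜ[ℚ_[p]] tprod ℚ_[p] (fun β => c • y β) =
        (c * ∏ _β : {β : A // β ≠ α}, c) • (x ⊗ₜ[ℚ_[p]] tprod ℚ_[p] y) := by
      rw [MultilinearMap.map_smul_univ, TensorProduct.tmul_smul, TensorProduct.smul_tmul',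
        TensorProduct.smul_tmul', smul_smul, mul_comm]
    set N : ℕ := n * (Fintype.card {β : A // β ≠ α} + 1) with hN
    have hnat : (c * ∏ _β : {β : A // β ≠ α}, c) = ((p ^ N : ℕ) : ℚ_[p]) := by
      rw [Finset.prod_const, Finset.card_univ, ← pow_succ', hc, ← pow_mul, Nat.cast_pow, hN, mul_comm]
    have key : ((p ^ N : ℕ) : ℚ) • (x ⊗ₜ[ℚ_[p]] tprod ℚ_[p] y) =
        (c • x) ⊗ₜ[ℚ_[p]] tprod ℚ_[p] (fun β => c • y β) := by
      rw [hrel, hnat, Nat.cast_smul_eq_nsmul ℚ_[p], Nat.cast_smul_eq_nsmul ℚ]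
    have hN0 : ((p ^ N : ℕ) : ℚ) ≠ 0 := by
      exact_mod_cast pow_ne_zero N (Fact.out : p.Prime).ne_zero
    have h := W.smul_mem (((p ^ N : ℕ) : ℚ)⁻¹) hmem
    rwa [← key, smul_smul, inv_mul_cancel₀ hN0, one_smul] at h
  -- pure tensors span (scalars of `ℚ_p` are absorbed into the first factor)
  rw [eq_top_iff]
  rintro t -
  induction t using TensorProduct.induction_on with
  | zero => exact W.zero_mem
  | tmul x z =>
    induction z using PiTensorProduct.induction_on with
    | smul_tprod r f =>
      rw [← TensorProduct.smul_tmul]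
      exact hA (r • x) f
    | add z₁ z₂ h₁ h₂ =>
      rw [TensorProduct.tmul_add]
      exact W.add_mem h₁ h₂
  | add t₁ t₂ h₁ h₂ => exact W.add_mem h₁ h₂

end RatSpan

/-! ### 2. The carriers of Prop. 3.4 (ii): label-`j` packets of the `(j+1)`-capsule of the ‡-procession -/

section Construction

variable (p : ℕ) [Fact p.Prime] {Vfib : Type v'} [Fintype Vfib]
variable (K : Vfib → Type w) [∀ v, NontriviallyNormedField (K v)] [∀ v, Algebra ℚ_[p] (K v)]
  [∀ v, IsBoundedSMul ℚ_[p] (K v)] [∀ v, IsUltrametricDist (K v)] [∀ v, CharZero (K v)]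
variable (Lg : ∀ v, PadicLogOnUnits (K v))

/-- The factors of the `(n+1)`-capsule `{‡𝔉_i}_{i ∈ S^±_{n+1}}` of the ‡-procession ([IUTchIII] Prop. 3.4 (ii) p. 102
l. 24–31; [IUTchI] Prop. 6.9 (i)): every member is (a labelled copy of) the ‡-side `𝓕`-prime-strip, so the factor
field at `(i, w)` is `K_w`. [cite: Mochizuki2012, Prop. 3.4 (ii) p.102] [claim: Mochizuki2012, status: disputed] -/
abbrev capsuleFields (n : ℕ) : Fin (n + 1) → Vfib → Type w := fun _ w => K w

/-- `log(^{S^±_{j+1},j;‡}𝓕_v)` ([IUTchIII] Prop. 3.4 (ii) p. 103 l. 8): abc-iut-L6-t4's `(A, α)`-packet `PacketAt`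
(Prop. 3.1 (ii)) for `A := S^±_{j+1} = Fin (j+1)` and `α :=` the label `j` (the last index), `j = labelNat i ∈
{1, …, l⋇}`. [cite: Mochizuki2012, Prop. 3.4 (ii) p.103] [claim: Mochizuki2012, status: disputed] -/
abbrev LGPPacket {lstar : ℕ} (v : Vfib) (j : Fin lstar) : Type _ :=
  PacketAt ℚ_[p] (capsuleFields K (labelNat j)) (Fin.last (labelNat j)) v

/-- The ring homomorphism `log(^j‡𝓕_v) = K_v → log(^{S^±_{j+1},j;‡}𝓕_v)` "tensor with `1`'s" of Prop. 3.1 (ii)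
(abc-iut-L6-t4's `toPacketAt`) at the label `j`, as a monoid homomorphism — the map through which (i)'s
"single packet monoids" are formed. [cite: Mochizuki2012, Prop. 3.1 (ii) p.93] [claim: Mochizuki2012, status: disputed] -/
abbrev toLGPPacket {lstar : ℕ} (v : Vfib) (j : Fin lstar) : K v →* LGPPacket p K v j :=
  (toPacketAt ℚ_[p] (capsuleFields K (labelNat j)) (Fin.last (labelNat j)) v).toRingHom.toMonoidHom

/-- `𝓘(^{S^±_{j+1},j;‡}𝒟^⊢_v) ⊆ log(^{S^±_{j+1},j;‡}𝓕_v)`: the packet log-shell of Prop. 3.2 (ii) (abc-iut-L6-t4's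
`shellPacketAt`) generated by the tensors of elements of abc-iut-L4-t3's local log-shells `ℐ_w = (p*)⁻¹·log(𝒪^×_w)`
(`logShell (Lg w)`; "with `𝒟^⊢` replaced by `𝓕`", p. 99, along the identity member of Prop. 3.2 (i)).
[cite: Mochizuki2012, Prop. 3.2 (ii) p.98] [claim: Mochizuki2012, status: disputed] -/
abbrev lgpShell {lstar : ℕ} (v : Vfib) (j : Fin lstar) : AddSubgroup (LGPPacket p K v j) :=
  shellPacketAt ℚ_[p] (capsuleFields K (labelNat j)) (fun _ w => AddSubgroup.closure (logShell (Lg w)))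
    (Fin.last (labelNat j)) v

/-- **`𝓘^ℚ(^{S^±_{j+1},j;‡}𝓕_v)`** := "the `ℚ`-span of `𝓘((−))`" ([IUTchIII] Prop. 3.2 (ii) p. 99): the TYPED object of
record — abc-iut-L6-t4's `shellQSpan` over `𝕜 = ℚ_p` of `lgpShell` (as in abc-iut-w4-d036 / w5-d086 p421013) — regarded as a
`ℚ`-submodule; it EQUALS the literal `ℚ`-span (`lgpShellQ_eq_shellQSpan_rat`).
[cite: Mochizuki2012, Prop. 3.2 (ii) p.99] [claim: Mochizuki2012, status: disputed] -/
def lgpShellQ {lstar : ℕ} (v : Vfib) (j : Fin lstar) : Submodule ℚ (LGPPacket p K v j) :=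
  (shellQSpan ℚ_[p] (lgpShell p K Lg v j)).restrictScalars ℚ

/-- `𝓘^ℚ(^{S^±_{j+1},j;‡}𝓕_v)` is the whole packet `log(^{S^±_{j+1},j;‡}𝓕_v)` — abc-iut-w4-d036's
`shellQSpan_shellPacketAt_eq_top` BY NAME (cf. w5-d086's one-place `LGPMonoidSignature.iQShell_eq_top`).
[cite: Mochizuki2012, Prop. 3.2 (ii) p.99] [claim: Mochizuki2012, status: disputed] -/
theorem lgpShellQ_eq_top {lstar : ℕ} (v : Vfib) (j : Fin lstar) : lgpShellQ p K Lg v j = ⊤ := by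
  rw [lgpShellQ, Submodule.restrictScalars_eq_top_iff]
  exact shellQSpan_shellPacketAt_eq_top p (capsuleFields K (labelNat j)) (fun _ w => Lg w) (Fin.last (labelNat j)) v

/-- The typed `𝓘^ℚ` (the `ℚ_p`-span, scalars restricted to `ℚ`) IS print's literal `ℚ`-span of the packet log-shell —
the kernel form of the remark in abc-iut-L6-t4's `shellQSpan` docstring ("the `ℚ`-span and the `𝕜`-span coincide"),
here because both are the whole packet. [cite: Mochizuki2012, Prop. 3.2 (ii) p.99] [claim: Mochizuki2012, status: disputed] -/
theorem lgpShellQ_eq_shellQSpan_rat {lstar : ℕ} (v : Vfib) (j : Fin lstar) :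
    lgpShellQ p K Lg v j = shellQSpan ℚ (lgpShell p K Lg v j) := by
  rw [lgpShellQ_eq_top, shellQSpan,
    span_rat_shellPacketAt_eq_top p (capsuleFields K (labelNat j)) (fun _ w => Lg w) (Fin.last (labelNat j)) v]

/-! ### 3. The construction `LGPMonoidSignature.ofGaussian` (Prop. 3.4 (ii), rows r14 / r11 / r16 / r17) -/

variable {lstar : ℕ} (isBad : Vfib → Prop)
variable (M : Vfib → Type w') [∀ v, CommMonoid (M v)]
variable (Γ : Vfib → Type w'') [∀ v, Monoid (Γ v)] [∀ v, MulDistribMulAction (Γ v) (M v)]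
variable (ι : ∀ v, M v →* K v)

/-- The label-dependent composite `M_v → K_v → log(^{S^±_{j+1},j;‡}𝓕_v)`: the pull-back member `ι v` followed by the
label-`j` packet map (p. 102 l. 31–37 "applying … (i) … in the case of the label `j` … to the pull-backs"). The
ENTIRE LGP-monoid `Ψ_{𝓕LGP}(†𝓗𝓣^{Θ±ellNF})_v ⊆ ∏_{j ∈ F_l^⋇} log(^{S^±_{j+1},j;‡}𝓕_v)` (p. 103 l. 7; Fig. 3.1 p. 101) is the
(pulled-back) Gaussian monoid `S ⊆ ∏_{F_l^⋇} M_v` read through the family `(lgpPush v j)_j` (abc-iut-L6-t2's `piMap`);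
this file records its label-`j` COMPONENTS (`lgpComponent`), which is what the output signature asks for.
[cite: Mochizuki2012, Prop. 3.4 (ii) p.102] [claim: Mochizuki2012, status: disputed] -/
def lgpPush (v : Vfib) (j : Fin lstar) : M v →* LGPPacket p K v j := (toLGPPacket p K v j).comp (ι v)

/-- "the component labeled `j`" (p. 103 l. 6, l. 14) of the entire LGP-monoid determined by `S ⊆ ∏_{F_l^⋇} M_v`: the
image under `toPacketAt_j ∘ ι_v` of the label-`j` component `pr_j(S) ⊆ M_v` — i.e. Prop. 3.4 (i)'s single packet
monoid construction applied at the label `j` (`LGPMonoidSignature.ofGaussian_Ψ`).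
[cite: Mochizuki2012, Prop. 3.4 (ii) p.103] [claim: Mochizuki2012, status: disputed] -/
def lgpComponent (v : Vfib) (S : Submonoid (Fin lstar → M v)) (j : Fin lstar) :
    Submonoid (LGPPacket p K v j) :=
  (S.map (Pi.evalMonoidHom (fun _ : Fin lstar => M v) j)).map (lgpPush p K M ι v j)

/-- The unit portion `S^×` of a submonoid `S` (elements of `S` invertible INSIDE `S`), as a submonoid of the
ambient monoid (p. 103 l. 16 "the unit portion `Ψ_{𝓕LGP}(†𝓗𝓣^{Θ±ellNF})^×_v`"; same shape as abc-iut-L6-t4's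
`singlePacketUnits`). [cite: Mochizuki2012, Prop. 3.4 (ii) p.103] [claim: Mochizuki2012, status: disputed] -/
def unitsIn {X : Type*} [Monoid X] (S : Submonoid X) : Submonoid X := (IsUnit.submonoid S).map S.subtype

/-- `S^× ⊆ S`. [cite: Mochizuki2012, Prop. 3.4 (ii) p.103] [claim: Mochizuki2012, status: disputed] -/
theorem unitsIn_le {X : Type*} [Monoid X] (S : Submonoid X) : unitsIn S ≤ S := by
  rintro _ ⟨u, -, rfl⟩
  exact u.2

/-- "the submonoid of Galois invariants" (p. 103 l. 6, l. 15: the `†Π_v ↠ G_v`-action of (i), "trivial when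
`v ∈ V^arc`"): the fixed points of the diagonal `Γ v`-action on `∏_{F_l^⋇} M_v` (Mathlib `FixedPoints.submonoid`).
[cite: Mochizuki2012, Prop. 3.4 (ii) p.103] [claim: Mochizuki2012, status: disputed] -/
abbrev galFixed (v : Vfib) : Submonoid (Fin lstar → M v) := FixedPoints.submonoid (Γ v) (Fin lstar → M v)

variable (gau gauInf : ∀ v, Submonoid (Fin lstar → M v))
variable (split : ∀ v, isBad v → Submonoid (Fin lstar → M v))

/-- **[IUTchIII] Prop. 3.4 (ii) CONSTRUCTED (sub-DAG row r14): `LGPMonoidSignature.ofGaussian`** — the inhabitant of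
abc-iut-L6-t4's output signature `LGPMonoidSignature` over the places of one nonarchimedean fibre, with
carriers the REAL label-`j` packets `log(^{S^±_{j+1},j;‡}𝓕_v)` and `𝓘^ℚ` the typed span of the packet log-shell (= print's
literal `ℚ`-span, `lgpShellQ_eq_shellQSpan_rat`),
built from the †-side Gaussian data of [IUTchII] Cor. 4.6 (iv) (`gau = Ψ_{𝓕gau}(†𝓗𝓣^Θ)_v`, `gauInf = ∞Ψ_{𝓕gau}`,
`split = ` the splitting up to torsion at bad `v`, `split ≤ gau`) pulled back along the member `ι v` of the
log-link's poly-isomorphism and pushed by "(i) at the label `j`": `Ψ` / `ΨInf` / `ΨSplit` = components of the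
entire LGP-monoid (`lgpComponent`), `ΨGal` = components of the image of the `Γ v`-fixed part, `ΨUnitsGal` = of the fixed
units. The two printed properties (p. 103 l. 5–14 bad places; l. 14–24 all places) are PROVED — `𝓘^ℚ` is the whole
packet (`lgpShellQ_eq_top`). [cite: Mochizuki2012, Prop. 3.4 (ii) p.102] [claim: Mochizuki2012, status: disputed] -/
def LGPMonoidSignature.ofGaussian (split_le : ∀ v (h : isBad v), split v h ≤ gau v) :
    LGPMonoidSignature lstar Vfib isBad (fun v j => LGPPacket p K v j) (fun v j => lgpShellQ p K Lg v j) where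
  Ψ v j := lgpComponent p K M ι v (gau v) j
  ΨInf v j := lgpComponent p K M ι v (gauInf v) j
  ΨGal v j := lgpComponent p K M ι v (gau v ⊓ galFixed M Γ v) j
  gal_le v j := Submonoid.monotone_map (Submonoid.monotone_map inf_le_left)
  ΨUnitsGal v j := lgpComponent p K M ι v (unitsIn (gau v) ⊓ galFixed M Γ v) j
  unitsGal_le v j :=
    Submonoid.monotone_map (Submonoid.monotone_map (inf_le_inf_right _ (unitsIn_le (gau v))))
  ΨSplit v h j := lgpComponent p K M ι v (split v h) j
  split_le v h j := Submonoid.monotone_map (Submonoid.monotone_map (split_le v h))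
  bad_gal_subset v _ j := by
    rw [lgpShellQ_eq_top, Submodule.top_coe]
    exact subset_univ _
  bad_gal_acts v _ j _ _ _ _ := by
    rw [lgpShellQ_eq_top]
    exact Submodule.mem_top
  unitsGal_subset v j := by
    rw [lgpShellQ_eq_top, Submodule.top_coe]
    exact subset_univ _
  unitsGal_acts v j _ _ _ _ := by
    rw [lgpShellQ_eq_top]
    exact Submodule.mem_top

variable (split_le : ∀ v (h : isBad v), split v h ≤ gau v)

/-- **Sub-DAG row r11 — the identity "`Ψ v j =` (i) applied at the label `j`"**: the `j`-component of the constructed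
LGP-monoid IS abc-iut-L6-t4's single packet monoid (Prop. 3.4 (i), `singlePacketMonoid` = image along `toPacketAt`)
of the label-`j` component `ι_v(pr_j(Ψ_{𝓕gau}(†𝓗𝓣^Θ)_v)) ⊆ log(^j‡𝓕_v)` of the pulled-back Gaussian monoid.
[cite: Mochizuki2012, Prop. 3.4 (ii) p.102] [claim: Mochizuki2012, status: disputed] -/
theorem LGPMonoidSignature.ofGaussian_Ψ (v : Vfib) (j : Fin lstar) :
    (LGPMonoidSignature.ofGaussian p K Lg isBad M Γ ι gau gauInf split split_le).Ψ v j =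
      singlePacketMonoid (𝕜 := ℚ_[p]) (Lv := K v) (Pv := LGPPacket p K v j)
        (toPacketAt ℚ_[p] (capsuleFields K (labelNat j)) (Fin.last (labelNat j)) v)
        (((gau v).map (Pi.evalMonoidHom (fun _ : Fin lstar => M v) j)).map (ι v)) := by
  change lgpComponent p K M ι v (gau v) j = _
  simp only [lgpComponent, singlePacketMonoid, Submonoid.map_map]
  ext y
  constructor
  · rintro ⟨x, hx, rfl⟩
    exact ⟨x, hx, rfl⟩
  · rintro ⟨x, hx, rfl⟩
    exact ⟨x, hx, rfl⟩

omit [Fintype Vfib] [∀ v, IsBoundedSMul ℚ_[p] (K v)] [∀ v, IsUltrametricDist (K v)] [∀ v, CharZero (K v)] in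
/-- Membership in a component: `y ∈ (Ψ)_j` iff `y = toPacketAt_j (ι_v (x_j))` for some `x` in the Gaussian datum.
[cite: Mochizuki2012, Prop. 3.4 (ii) p.102] [claim: Mochizuki2012, status: disputed] -/
theorem mem_lgpComponent_iff (v : Vfib) (S : Submonoid (Fin lstar → M v)) (j : Fin lstar)
    (y : LGPPacket p K v j) :
    y ∈ lgpComponent p K M ι v S j ↔ ∃ x ∈ S, lgpPush p K M ι v j (x j) = y := by
  constructor
  · rintro ⟨_, ⟨x, hx, rfl⟩, rfl⟩
    exact ⟨x, hx, rfl⟩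
  · rintro ⟨x, hx, rfl⟩
    exact ⟨x j, ⟨x, hx, rfl⟩, rfl⟩

/-- The Galois-invariant units pushed forward ARE units of the constructed LGP-monoid component (so `ΨUnitsGal` lies
in the unit portion of `Ψ`, as printed p. 103 l. 16). [cite: Mochizuki2012, Prop. 3.4 (ii) p.103]
[claim: Mochizuki2012, status: disputed] -/
theorem LGPMonoidSignature.ofGaussian_ΨUnitsGal_le_unitsIn (v : Vfib) (j : Fin lstar) :
    (LGPMonoidSignature.ofGaussian p K Lg isBad M Γ ι gau gauInf split split_le).ΨUnitsGal v j ≤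
      unitsIn ((LGPMonoidSignature.ofGaussian p K Lg isBad M Γ ι gau gauInf split split_le).Ψ v j) := by
  intro y hy
  change y ∈ lgpComponent p K M ι v (unitsIn (gau v) ⊓ galFixed M Γ v) j at hy
  change y ∈ unitsIn (lgpComponent p K M ι v (gau v) j)
  rw [mem_lgpComponent_iff] at hy
  obtain ⟨x, ⟨hxu, -⟩, rfl⟩ := hy
  obtain ⟨u, hu, rfl⟩ := Submonoid.mem_map.mp hxu
  rw [IsUnit.mem_submonoid_iff] at hu
  obtain ⟨w, hw⟩ := hu
  -- the pushed unit, as a unit of the component monoid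
  let f : ↥(gau v) →* ↥(lgpComponent p K M ι v (gau v) j) :=
    { toFun := fun x => ⟨lgpPush p K M ι v j ((x : Fin lstar → M v) j),
        (mem_lgpComponent_iff p K M ι v (gau v) j _).mpr ⟨x, x.2, rfl⟩⟩
      map_one' := by ext; simp
      map_mul' := fun x y => by ext; simp }
  refine Submonoid.mem_map.mpr ⟨f u, ?_, rfl⟩
  rw [IsUnit.mem_submonoid_iff]
  exact ⟨Units.map f w, by rw [Units.coe_map, hw]⟩

/-! ### 4. Instantiation at the Gaussian monoids of [IUTchII] Cor. 3.5 / 3.6 (iv) (bad places) -/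

variable (twoL : ℕ) (ξ : ∀ v, Fin lstar → M v)

/-- **Prop. 3.4 (ii) at the Gaussian monoids of record**: `LGPMonoidSignature.ofGaussian` fed with abc-iut-L6-t2's REAL
[IUTchII] Cor. 3.5 (ii) / 3.6 (iii) objects for a value-profile `ξ_v ∈ ∏_{F_l^⋇} M_v` at each place — Gaussian monoid
`Ψ_ξ = Ψ^×_{⟨F_l^⋇⟩} · ξ^ℕ` (`gaussianMonoid`), `∞Ψ_ξ` (`inftyGaussianMonoid`) and, at bad `v`, the splitting up to torsion
`μ_{2l}^{diag} · ξ^ℕ` (`gaussianSplittingMonoid`, `≤ Ψ_ξ` by `gaussianSplittingMonoid_le_gaussianMonoid`).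
[cite: Mochizuki2012, Prop. 3.4 (ii) p.102] [claim: Mochizuki2012, status: disputed] -/
def LGPMonoidSignature.ofValueProfile :
    LGPMonoidSignature lstar Vfib isBad (fun v j => LGPPacket p K v j) (fun v j => lgpShellQ p K Lg v j) :=
  LGPMonoidSignature.ofGaussian p K Lg isBad M Γ ι (fun v => gaussianMonoid (ξ v))
    (fun v => inftyGaussianMonoid (ξ v)) (fun v _ => gaussianSplittingMonoid (M v) twoL (ξ v))
    (fun v _ => gaussianSplittingMonoid_le_gaussianMonoid twoL (ξ v))

variable (q : ∀ v, M v) (ζ : ∀ v, Fin lstar → (M v)ˣ)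

/-- **Junction with Prop. 3.5 (ii)(c) (sub-DAG rows Prop-34 r16 / Prop-35)**: for the value-profile
`ξ_v = (ζ_{v,j} · q_v^{j²})_j` with `ζ_{v,j} ∈ μ_{2l}` ([IUTchII] Rmk. 2.5.1 (i)/(iii), Cor. 3.5 (ii)) the label-`j`
SPLITTING MONOID of the constructed LGP-monoid at a bad place lies in abc-iut-L6-t2's
`splittingMonoidAt K_v 2l (ι_v q_v) j = μ_{2l} · q^{j²ℕ}` pushed to the packet by `toPacketAt_j` — the very object on
which abc-iut-w4-d036 proved [IUTchIII] Prop. 3.5 (ii)(c) at the packet (`prop35ii_c_shellPacketAt`), i.e. Fig. 3.1's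
"`q^{j²}` at the label `j`". [cite: Mochizuki2012, Prop. 3.4 (ii) p.102] [claim: Mochizuki2012, status: disputed] -/
theorem LGPMonoidSignature.ofValueProfile_ΨSplit_le (hζ : ∀ v j, ζ v j ∈ rootsOfUnity twoL (M v))
    (v : Vfib) (h : isBad v) (j : Fin lstar) :
    (LGPMonoidSignature.ofValueProfile p K Lg isBad M Γ ι twoL
        (fun v => valueProfileOf (q v) (fun j => labelNat j ^ 2) (ζ v))).ΨSplit v h j ≤
      (splittingMonoidAt (K v) twoL (ι v (q v)) (labelNat j)).map (toLGPPacket p K v j) := by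
  intro y hy
  change y ∈ lgpComponent p K M ι v (gaussianSplittingMonoid (M v) twoL _) j at hy
  rw [mem_lgpComponent_iff] at hy
  obtain ⟨x, hx, rfl⟩ := hy
  have hxj : x j ∈ splittingMonoidAt (M v) twoL (q v) (labelNat j) := apply_mem_splittingMonoidAt (hζ v) hx j
  have hι : ι v (x j) ∈ splittingMonoidAt (K v) twoL (ι v (q v)) (labelNat j) :=
    map_splittingMonoidAt_le (ι v) twoL (q v) (labelNat j) ⟨x j, hxj, rfl⟩
  exact ⟨ι v (x j), hι, rfl⟩

end Construction

end Literature.IUT.LogThetaLattice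

end
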